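import Summits.KontsevichZagierPeriods.KontsevichZagierPeriods.Theorems.HurwitzMicroSectorsNormalFormPrincipleM2FiveZetaTwo

/-!
# `NormalFormPrinciple` (stmt-KontsevichZagierPeriods-3869), line `SketchIdeator1` — leaf `stub_boxRigidity`:
# the cyclotomic log layer: the ζ(2) block with a rational weight

Registered sub-goal `logMonomialInv_sub_zetaBand_rat` of the cyclotomic log layer: for a rational
weight `c`, the unfolded logarithmic monomial `L = [{0 < x < 1, 1 ≤ s ≤ 1/(1 − x)}, (c/x)/s]` (value
`c ζ(2)`) and the band-box representation `Z = [{0 < x < 1, 0 ≤ θ ≤ 1}, c/(1 − xθ)]` differ by a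
relation of the Kontsevich–Zagier calculus (rule 2 only). This is the verbatim generalisation of
the case `c = 1` (`logMonomialInv_sub_zetaBand`):

1. the fibrewise substitution `s = 1 + θ (v(x) − 1)`, `v(x) = 1/(1 − x)`
   (`KZ.of_sub_of_mem_relations_fibreSubst`) carries `L` to the auxiliary band-box representation
   `Zc = [{0 < x < 1, 0 ≤ θ ≤ 1}, c/(1 − x(1 − θ))]`, by the identity
   `(c/x) (v − 1)/(1 + θ (v − 1)) = c/(1 − x + θx)`;
2. the reflection `θ ↦ 1 − θ` of the last coordinate (`KZ.boxReflection 1`,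
   `KZ.of_sub_of_mem_relations_of_boxReflection`) carries `Zc` to `Z`; the absolute convergence of
   `Zc` is that of `Z` transported along the reflection (Jacobian of absolute value `1`).

Nothing in the argument uses the sign of `c`.
References: M. Kontsevich, D. Zagier, *Periods* (2001), §1.2 rule (2). No definitions are
introduced.
-/

noncomputable section

open MeasureTheory Set
open Literature.NumberTheory.Transcendental Literature.NumberTheory.Transcendental.KZ
open Literature.ModelTheory.ExponentialFields (IsSemialgebraic)

namespace Summit.KontsevichZagierPeriods.HurwitzMicroSectors.NormalFormPrinciple.PiBox.M2

/-- The pull-back identity of the fibrewise substitution `s = 1 + θ (v − 1)`, `v = 1/(1 − x)`, with a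
weight `c`: `c/(1 − x(1 − θ)) = (c/x)(v − 1)/(1 + θ(v − 1))` for `0 < x < 1`, `0 ≤ θ`. [folklore] -/
theorem zetaBand_fibreSubst_identity_weight {x θ : ℝ} (c : ℝ) (hx0 : 0 < x) (hx1 : x < 1)
    (hθ0 : 0 ≤ θ) :
    c / (1 - x * (1 - θ)) = c / x * (1 / (1 - x) - 1) / (1 + θ * (1 / (1 - x) - 1)) := by
  calc c / (1 - x * (1 - θ)) = c * (1 / (1 - x * (1 - θ))) := by rw [mul_one_div]
    _ = c * (1 / x * (1 / (1 - x) - 1) / (1 + θ * (1 / (1 - x) - 1))) := by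
      rw [zetaBand_fibreSubst_identity hx0 hx1 hθ0]
    _ = c / x * (1 / (1 - x) - 1) / (1 + θ * (1 / (1 - x) - 1)) := by ring

/-- **Stub (the ζ(2) block with a rational weight: fibre substitution + reflection, Kontsevich–Zagier
rule 2).** For `c ∈ ℚ`, the unfolded logarithmic monomial
`M(c/x, 1/(1 − x)) = [{0 < x < 1, 1 ≤ s ≤ 1/(1 − x)}, (c/x)/s]` (value `c ζ(2)`) and the band-box
representation `[{0 < x < 1, 0 ≤ θ ≤ 1}, c/(1 − xθ)]` differ by a relation: the fibrewise
substitution `s = 1 + θ(v − 1)` with `v = 1/(1 − x)` (`KZ.of_sub_of_mem_relations_fibreSubst`) lands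
on `[band-box, c/(1 − x(1 − θ))]`, and the reflection `θ ↦ 1 − θ`
(`KZ.of_sub_of_mem_relations_of_boxReflection`) on `[band-box, c/(1 − xθ)]`.
[cite: KontsevichZagier2001, §1.2 rule (2)] -/
theorem logMonomialInv_sub_zetaBand_rat (c : ℚ) (L Z : IntegralRep 2)
    (hLd : L.domain = KZlog.band {y : Fin 1 → ℝ | 0 < y 0 ∧ y 0 < 1} (fun _ => (1:ℝ)) (fun y => 1 / (1 - y 0)))
    (hLi : EqOn L.integrand (fun z => ((c : ℝ) / z 0) / z 1) L.domain)
    (hZd : Z.domain = KZlog.band {y : Fin 1 → ℝ | 0 < y 0 ∧ y 0 < 1} (fun _ => (0:ℝ)) (fun _ => (1:ℝ)))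
    (hZi : EqOn Z.integrand (fun z => (c : ℝ) / (1 - z 0 * z 1)) Z.domain) :
    of L - of Z ∈ relations := by
  -- the open base `(0,1) ⊆ ℝ¹` and the band-box over it
  have hG : IsSemialgebraic ℚ {y : Fin 1 → ℝ | 0 < y 0 ∧ y 0 < 1} :=
    isSemialgebraic_unitInterval_fin_one
  have hB : IsSemialgebraic ℚ
      (KZlog.band {y : Fin 1 → ℝ | 0 < y 0 ∧ y 0 < 1} (fun _ => (0:ℝ)) (fun _ => (1:ℝ))) :=
    KZlog.isSemialgebraic_band (by simpa using isSemialgebraicFunOn_ratCast hG 0)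
      (by simpa using isSemialgebraicFunOn_ratCast hG 1)
  have hBm : MeasurableSet
      (KZlog.band {y : Fin 1 → ℝ | 0 < y 0 ∧ y 0 < 1} (fun _ => (0:ℝ)) (fun _ => (1:ℝ))) :=
    Literature.ModelTheory.ExponentialFields.IsSemialgebraic.measurableSet_holds hB
  -- the reflected kernel `c/(1 − x(1 − θ))` is semialgebraic on the band-box ...
  have hsa : IsSemialgebraicFunOn ℚ
      (KZlog.band {y : Fin 1 → ℝ | 0 < y 0 ∧ y 0 < 1} (fun _ => (0:ℝ)) (fun _ => (1:ℝ)))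
      (fun z => (c : ℝ) / (1 - z 0 * (1 - z 1))) := by
    refine (isSemialgebraicFunOn_aeval_div_aeval hB (MvPolynomial.C c)
      (1 - MvPolynomial.X 0 * (1 - MvPolynomial.X 1)) fun x hx => ?_).congr fun x _ => by simp
    simp only [map_sub, map_mul, map_one, MvPolynomial.aeval_X]
    exact (zetaBand_one_sub_mul_one_sub_pos hx).ne'
  -- ... and integrable there: transport of the integrability of `Z` along the reflection
  have hZint : IntegrableOn (fun z : Fin 2 → ℝ => (c : ℝ) / (1 - z 0 * z 1))
      (KZlog.band {y : Fin 1 → ℝ | 0 < y 0 ∧ y 0 < 1} (fun _ => (0:ℝ)) (fun _ => (1:ℝ))) := by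
    have h := Z.integrableOn.congr_fun hZi (IntegralRep.measurableSet_domain_holds Z)
    rwa [hZd] at h
  obtain ⟨Lr, hdet, hLr⟩ := exists_hasFDerivAt_boxReflection (1 : Fin 2)
  have himg : boxReflection 1 ''
        KZlog.band {y : Fin 1 → ℝ | 0 < y 0 ∧ y 0 < 1} (fun _ => (0:ℝ)) (fun _ => (1:ℝ)) =
      KZlog.band {y : Fin 1 → ℝ | 0 < y 0 ∧ y 0 < 1} (fun _ => (0:ℝ)) (fun _ => (1:ℝ)) := by
    conv_lhs => rw [← zetaBand_preimage_boxReflection]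
    exact image_preimage_eq _ (boxReflection_involutive 1).surjective
  have hint : IntegrableOn (fun z : Fin 2 → ℝ => (c : ℝ) / (1 - z 0 * (1 - z 1)))
      (KZlog.band {y : Fin 1 → ℝ | 0 < y 0 ∧ y 0 < 1} (fun _ => (0:ℝ)) (fun _ => (1:ℝ))) := by
    have key := (integrableOn_image_iff_integrableOn_abs_det_fderiv_smul volume hBm
      (f' := fun _ => Lr) (fun x _ => (hLr x).hasFDerivWithinAt)
      (boxReflection_involutive 1).injective.injOn
      (fun z : Fin 2 → ℝ => (c : ℝ) / (1 - z 0 * z 1))).1 (by rw [himg]; exact hZint)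
    refine key.congr_fun (fun x _ => ?_) hBm
    simp only [hdet, one_smul, boxReflection_apply_self,
      boxReflection_apply_of_ne (show (0 : Fin 2) ≠ 1 by decide)]
  -- the auxiliary representation `Zc = [band-box, c/(1 − x(1 − θ))]`
  obtain ⟨Zc, hcd, hci⟩ : ∃ Zc : IntegralRep 2,
      Zc.domain = KZlog.band {y : Fin 1 → ℝ | 0 < y 0 ∧ y 0 < 1} (fun _ => (0:ℝ)) (fun _ => (1:ℝ)) ∧
      Zc.integrand = fun z => (c : ℝ) / (1 - z 0 * (1 - z 1)) :=
    ⟨⟨_, _, hB, hsa, hint⟩, rfl, rfl⟩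
  -- (rule 2, fibrewise substitution `s = 1 + θ (v − 1)`, `v = 1/(1 − x)`) `L` versus `Zc`
  have hv : IsSemialgebraicFunOn ℚ {y : Fin 1 → ℝ | 0 < y 0 ∧ y 0 < 1}
      (fun y => 1 / (1 - y 0)) := by
    refine (isSemialgebraicFunOn_aeval_div_aeval hG 1 (1 - MvPolynomial.X 0)
      fun y hy => ?_).congr fun y _ => by simp
    have h : 0 < y 0 ∧ y 0 < 1 := hy
    simp only [map_sub, map_one, MvPolynomial.aeval_X]
    exact (sub_pos.2 h.2).ne'
  have hv1 : ∀ y ∈ {y : Fin 1 → ℝ | 0 < y 0 ∧ y 0 < 1}, (1:ℝ) ≤ 1 / (1 - y 0) := by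
    intro y hy
    have h : 0 < y 0 ∧ y 0 < 1 := hy
    exact one_le_one_div (sub_pos.2 h.2) (by linarith [h.1])
  have e1 : of L - of Zc ∈ relations := by
    refine of_sub_of_mem_relations_fibreSubst (m := 1) (f := fun y => (c : ℝ) / y 0)
      (v := fun y => 1 / (1 - y 0)) hG hv hv1 L Zc hLd (fun z hz => hLi hz) hcd fun z hz => ?_
    rw [hcd] at hz
    have h : (0 < z 0 ∧ z 0 < 1) ∧ 0 ≤ z 1 ∧ z 1 ≤ 1 := hz
    rw [hci]
    show (c : ℝ) / (1 - z 0 * (1 - z 1)) =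
      (c : ℝ) / z 0 * (1 / (1 - z 0) - 1) / (1 + z 1 * (1 / (1 - z 0) - 1))
    exact zetaBand_fibreSubst_identity_weight (c : ℝ) h.1.1 h.1.2 h.2.1
  -- (rule 2, reflection `θ ↦ 1 − θ`) `Zc` versus `Z`
  have e2 : of Zc - of Z ∈ relations := by
    refine of_sub_of_mem_relations_of_boxReflection (1 : Fin 2) ?_ fun x hx => ?_
    · rw [hcd, hZd, zetaBand_preimage_boxReflection]
    · have hx' : boxReflection 1 x ∈ Z.domain := by
        rw [hZd, ← mem_preimage, zetaBand_preimage_boxReflection, ← hcd]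
        exact hx
      rw [hZi hx', hci]
      simp only [boxReflection_apply_self,
        boxReflection_apply_of_ne (show (0 : Fin 2) ≠ 1 by decide)]
  -- bookkeeping
  have e : of L - of Z = (of L - of Zc) + (of Zc - of Z) := by abel
  rw [e]
  exact relations.add_mem e1 e2

end Summit.KontsevichZagierPeriods.HurwitzMicroSectors.NormalFormPrinciple.PiBox.M2
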